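import Summits.ValiantsHypothesis.ValiantsHypothesis.Theorems.DivisionGapSquareGridDimersDivisionEasyAztec

/-!
# Urban renewal on weighted Aztec diamonds: cell factorization and one shuffling round

The dimer partition function of a vertex set of the Aztec diamond graph factorizes over the cells once
the boundary types (which corners of each cell are matched inside the cell) are fixed
(`Z_eq_sum_cons`); Propp's urban renewal lemma becomes the `16`-case local identity
`Zloc_eq_cf_mul_Zloc_compl`, and complementing all boundary types at once gives one round of
generalized domino shuffling: `Z_univ_eq_prod_cf_mul_Z_inner` (Propp 2003, §2 statement, §5 proof).
[cite: Propp2003, §5]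

All `def … : Prop` declarations in this file are decidable predicates on finite data (not named facts).
Support file for `SquareGridDimersDivisionEasy` (route DivisionGap, item stmt-ValiantsHypothesis-5072);
the closing theorem is `squareGridDimersDivisionEasy_proof` in `…DivisionGapSquareGridDimersDivisionEasy.lean`.
-/

namespace Summit.ValiantsHypothesis.ValiantsHypothesis.Theorems

namespace SquareGridDimers

set_option linter.dupNamespace false

noncomputable section

open Finset

/-! ## The cell factorization of the partition function -/

/-- The local patterns of a given boundary type. [cite: Propp2003, §5] -/
def locOf (T : BType) : Finset (Finset Pos) := univ.filter (fun P => IsLocal P ∧ btype P = T)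

/-- Membership in `locOf`. [folklore] -/
@[simp] theorem mem_locOf (T : BType) (P : Finset Pos) : P ∈ locOf T ↔ IsLocal P ∧ btype P = T := by
  simp [locOf]

/-- The local partition function of one cell with edge weights `a` and prescribed boundary type `T`:
the sum over the local patterns of type `T` of the products of their edge weights. [cite: Propp2003, §5] -/
def Zloc {F : Type*} [CommSemiring F] (a : Pos → F) (T : BType) : F := ∑ P ∈ locOf T, ∏ p ∈ P, a p

/-- **Cell factorization.** The dimer partition function of `U` is the sum, over all families of
boundary types consistent with `U`, of the product over the cells of the local partition functions.
[cite: Propp2003, §5] -/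
theorem Z_eq_sum_cons {m : ℕ} {F : Type*} [CommSemiring F] (U : Finset (V m)) (ew : E m → F) :
    Z U ew = ∑ τ : Cell m → BType,
      if Cons U τ then ∏ c : Cell m, Zloc (fun p => ew (c, p)) (τ c) else 0 := by
  classical
  -- Step 1: reindex matchings by their families of slices.
  have h1 : Z U ew = ∑ g : Cell m → Finset Pos,
      if (∀ c, IsLocal (g c)) ∧ Cons U (fun c => btype (g c)) then ∏ c, ∏ p ∈ g c, ew (c, p) else 0 := by
    unfold Z pmSet
    rw [sum_filter]
    refine Finset.sum_equiv (sliceEquiv m) (fun M => by simp) (fun M _ => ?_)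
    simp only [sliceEquiv, Equiv.coe_fn_mk]
    rw [prod_eq_prod_slice]
    exact if_congr (isPM_iff U M) rfl rfl
  -- Step 2: regroup by boundary types.
  rw [h1]
  symm
  calc (∑ τ : Cell m → BType, if Cons U τ then ∏ c : Cell m, Zloc (fun p => ew (c, p)) (τ c) else 0)
      = ∑ τ : Cell m → BType, ∑ g ∈ Fintype.piFinset (fun c => locOf (τ c)),
          if Cons U τ then ∏ c, ∏ p ∈ g c, ew (c, p) else 0 := by
        refine sum_congr rfl fun τ _ => ?_
        split_ifs with h
        · unfold Zloc
          rw [prod_univ_sum]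
        · simp
    _ = ∑ τ : Cell m → BType, ∑ g : Cell m → Finset Pos,
          if (g ∈ Fintype.piFinset (fun c => locOf (τ c)) ∧ Cons U τ) then
            ∏ c, ∏ p ∈ g c, ew (c, p) else 0 := by
        refine sum_congr rfl fun τ _ => ?_
        simp only [ite_and]
        rw [sum_ite_mem, univ_inter]
    _ = ∑ g : Cell m → Finset Pos, ∑ τ : Cell m → BType,
          if (τ = fun c => btype (g c)) then
            (if (∀ c, IsLocal (g c)) ∧ Cons U τ then ∏ c, ∏ p ∈ g c, ew (c, p) else 0) else 0 := by
        rw [sum_comm]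
        refine sum_congr rfl fun g _ => sum_congr rfl fun τ _ => ?_
        have : (g ∈ Fintype.piFinset (fun c => locOf (τ c)) ∧ Cons U τ) ↔
            ((τ = fun c => btype (g c)) ∧ ((∀ c, IsLocal (g c)) ∧ Cons U τ)) := by
          simp only [Fintype.mem_piFinset, mem_locOf, funext_iff]
          constructor
          · rintro ⟨h, hc⟩; exact ⟨fun c => (h c).2.symm, fun c => (h c).1, hc⟩
          · rintro ⟨h, hl, hc⟩; exact ⟨fun c => ⟨hl c, (h c).symm⟩, hc⟩
        simp only [this, ite_and]
    _ = _ := by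
        refine sum_congr rfl fun g _ => ?_
        rw [sum_ite_eq']
        simp

/-! ## Urban renewal: the local identity -/

/-- The opposite position in a cell (`W ↔ E`, `S ↔ N`). [cite: Propp2003, §2] -/
def opp (p : Pos) : Pos := (p.1.rev, p.2.rev)

/-- `opp` is an involution. [folklore] -/
@[simp] theorem opp_opp (p : Pos) : opp (opp p) = p := by simp [opp]

/-- The cell factor `wz + xy` of a cell (Propp's notation: `w, x, y, z` are the weights of the
NW, NE, SW, SE edges, here the positions `(0,1), (1,1), (0,0), (1,0)`). [cite: Propp2003, §2] -/
def cf {m : ℕ} {F : Type*} [CommSemiring F] (ew : E m → F) (c : Cell m) : F :=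
  ew (c, (0, 1)) * ew (c, (1, 0)) + ew (c, (1, 1)) * ew (c, (0, 0))

/-- The renewed weights on the same cells: every edge receives the weight of the opposite edge of
its cell divided by the cell factor (`w' = z/(wz+xy)` etc.). [cite: Propp2003, §2] -/
def rt {m : ℕ} {F : Type*} [Field F] (ew : E m → F) (e : E m) : F := ew (e.1, opp e.2) / cf ew e.1

/-- Complementary boundary type. [cite: Propp2003, §5] -/
def complT (T : BType) : BType := (univ \ T.1, univ \ T.2)

/-- Complementation of boundary types is an involution. [folklore] -/
@[simp] theorem complT_complT (T : BType) : complT (complT T) = T := by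
  obtain ⟨A, B⟩ := T
  simp [complT, sdiff_sdiff_right_self]

/-- Values of `opp`. [folklore] -/
@[simp] theorem opp_00 : opp (0, 0) = (1, 1) := by decide
/-- Values of `opp`. [folklore] -/
@[simp] theorem opp_11 : opp (1, 1) = (0, 0) := by decide
/-- Values of `opp`. [folklore] -/
@[simp] theorem opp_01 : opp (0, 1) = (1, 0) := by decide
/-- Values of `opp`. [folklore] -/
@[simp] theorem opp_10 : opp (1, 0) = (0, 1) := by decide

/-- A local pattern of boundary type `T` has as many edges as `T` has corners of either kind. [folklore] -/
theorem card_eq_of_mem_locOf {T : BType} {P : Finset Pos} (h : P ∈ locOf T) :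
    T.1.card = P.card ∧ T.2.card = P.card := by
  rw [mem_locOf] at h
  obtain ⟨⟨h1, h2⟩, rfl⟩ := h
  exact ⟨h1, h2⟩

/-- Unbalanced boundary types carry no local pattern. [folklore] -/
theorem locOf_eq_empty {T : BType} (h : T.1.card ≠ T.2.card) : locOf T = ∅ := by
  ext P
  simp only [Finset.notMem_empty, iff_false]
  intro hP
  obtain ⟨h1, h2⟩ := card_eq_of_mem_locOf hP
  exact h (h1.trans h2.symm)

/-- The empty boundary type carries exactly the empty pattern. [folklore] -/
theorem locOf_empty : locOf ((∅ : Finset (Fin 2)), (∅ : Finset (Fin 2))) = {∅} := by decide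

/-- The full boundary type carries exactly the two perfect matchings of the 4-cycle. [folklore] -/
theorem locOf_univ : locOf ((univ : Finset (Fin 2)), (univ : Finset (Fin 2))) =
    {{((0 : Fin 2), (0 : Fin 2)), (1, 1)}, {(0, 1), (1, 0)}} := by decide

/-- A singleton boundary type carries exactly one single edge. [folklore] -/
theorem locOf_single (δ ε : Fin 2) :
    locOf (({δ} : Finset (Fin 2)), ({ε} : Finset (Fin 2))) = {{(δ, ε)}} := by
  fin_cases δ <;> fin_cases ε <;> decide

/-- In `Fin 2`, the complement of a singleton is the singleton of the reversed element. [folklore] -/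
theorem univ_sdiff_singleton_fin_two (δ : Fin 2) : (univ : Finset (Fin 2)) \ {δ} = {δ.rev} := by
  fin_cases δ <;> decide

/-- A subset of `Fin 2` has `0`, `1` or `2` elements, and is then `∅`, a singleton, or `univ`. [folklore] -/
theorem finset_fin_two_cases (A : Finset (Fin 2)) :
    A = ∅ ∨ (∃ δ, A = {δ}) ∨ A = univ := by
  rcases Nat.lt_or_ge A.card 1 with h | h
  · left; exact card_eq_zero.mp (by omega)
  rcases Nat.lt_or_ge A.card 2 with h2 | h2
  · right; left; exact card_eq_one.mp (by omega)
  · right; right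
    exact eq_univ_of_card A (le_antisymm (card_le_univ A) (by simpa using h2))

/-- **Urban renewal, locally** (Propp 2003, §5, proof of the urban renewal lemma, by verification
over the `16` boundary conditions): the local partition function of a cell with boundary type `T`
equals the cell factor times the local partition function, for the renewed weights, of the
complementary boundary type. [cite: Propp2003, §5] -/
theorem Zloc_eq_cf_mul_Zloc_compl {F : Type*} [Field F] (a : Pos → F)
    (hcf : a (0, 1) * a (1, 0) + a (1, 1) * a (0, 0) ≠ 0) (T : BType) :
    Zloc a T = (a (0, 1) * a (1, 0) + a (1, 1) * a (0, 0)) *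
      Zloc (fun p => a (opp p) / (a (0, 1) * a (1, 0) + a (1, 1) * a (0, 0))) (complT T) := by
  set s := a (0, 1) * a (1, 0) + a (1, 1) * a (0, 0) with hs
  obtain ⟨A, B⟩ := T
  by_cases hAB : A.card = B.card
  · rcases finset_fin_two_cases A with rfl | ⟨δ, rfl⟩ | rfl
    · -- empty type ↔ full type
      have hB : B = ∅ := card_eq_zero.mp (by simpa using hAB.symm)
      subst hB
      simp only [Zloc, complT, sdiff_empty, locOf_empty, locOf_univ, sum_singleton, prod_empty]
      rw [sum_pair (by decide), prod_pair (by decide), prod_pair (by decide)]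
      simp only [opp_00, opp_11, opp_01, opp_10]
      field_simp
      ring
    · -- singleton types
      obtain ⟨ε, rfl⟩ : ∃ ε, B = {ε} := card_eq_one.mp (by simpa using hAB.symm)
      simp only [Zloc, complT, univ_sdiff_singleton_fin_two, locOf_single, sum_singleton,
        prod_singleton, opp, Fin.rev_rev]
      field_simp
    · -- full type ↔ empty type
      have hB : B = univ := eq_univ_of_card B (by simpa using hAB.symm)
      subst hB
      simp only [Zloc, complT, sdiff_self, locOf_univ]
      rw [sum_pair (by decide), prod_pair (by decide), prod_pair (by decide)]
      simp only [bot_eq_empty, locOf_empty, sum_singleton, prod_empty, mul_one, hs]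
      ring
  · have h1 : locOf (A, B) = ∅ := locOf_eq_empty hAB
    have h2 : locOf (complT (A, B)) = ∅ := by
      refine locOf_eq_empty ?_
      simp only [complT, card_univ_sdiff, Fintype.card_fin]
      have := card_le_univ A; have := card_le_univ B
      simp only [Fintype.card_fin] at *
      omega
    simp [Zloc, h1, h2]

/-! ## Urban renewal: the global round identity -/

/-- Inner vertices of the Aztec diamond of order `m + 1`: those that survive the renewal round
(Propp: after renewal the pendant outer vertices are stripped). [cite: Propp2003, §5] -/
def IsInner {m : ℕ} : V (m + 1) → Prop
  | Sum.inl (x, _) => 1 ≤ x.val ∧ x.val ≤ m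
  | Sum.inr (_, y) => 1 ≤ y.val ∧ y.val ≤ m

/-- Being inner is decidable. [folklore] -/
instance {m : ℕ} (v : V (m + 1)) : Decidable (IsInner v) := by
  rcases v with ⟨x, y⟩ | ⟨p, y⟩ <;> unfold IsInner <;> infer_instance

/-- The set of inner vertices. [cite: Propp2003, §5] -/
def inner (m : ℕ) : Finset (V (m + 1)) := univ.filter IsInner

/-- Membership in `inner`. [folklore] -/
@[simp] theorem mem_inner {m : ℕ} (v : V (m + 1)) : v ∈ inner m ↔ IsInner v := by simp [inner]

/-- The number of (cell, corner) incidences of a vertex. [folklore] -/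
def ninc {m : ℕ} : V m → ℕ
  | Sum.inl (x, _) => ∑ p : Fin m, ∑ δ : Fin 2, if p.val + δ.val = x.val then 1 else 0
  | Sum.inr (_, y) => ∑ q : Fin m, ∑ ε : Fin 2, if q.val + ε.val = y.val then 1 else 0

/-- Counting the solutions of `p + δ = x` with `p < m + 1`, `δ < 2`. [folklore] -/
theorem sum_sum_indicator_eq {m : ℕ} (x : Fin (m + 2)) :
    (∑ p : Fin (m + 1), ∑ δ : Fin 2, if p.val + δ.val = x.val then 1 else 0) =
      if 1 ≤ x.val ∧ x.val ≤ m then 2 else 1 := by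
  have h0 : ∀ p : Fin (m + 1), (∑ δ : Fin 2, if p.val + δ.val = x.val then (1 : ℕ) else 0) =
      (if p.val = x.val then 1 else 0) + (if p.val + 1 = x.val then 1 else 0) := by
    intro p; rw [Fin.sum_univ_two]; simp
  simp only [h0, sum_add_distrib]
  have h1 : (∑ p : Fin (m + 1), if p.val = x.val then (1 : ℕ) else 0) = if x.val ≤ m then 1 else 0 := by
    split_ifs with hx
    · rw [Finset.sum_eq_single ⟨x.val, by omega⟩]
      · simp
      · intro p _ hp; rw [if_neg]; intro h; exact hp (Fin.ext h)
      · simp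
    · exact sum_eq_zero fun p _ => by rw [if_neg]; omega
  have h2 : (∑ p : Fin (m + 1), if p.val + 1 = x.val then (1 : ℕ) else 0) =
      if 1 ≤ x.val then 1 else 0 := by
    split_ifs with hx
    · rw [Finset.sum_eq_single ⟨x.val - 1, by omega⟩]
      · simp only [ite_eq_left_iff]; omega
      · intro p _ hp; rw [if_neg]; intro h; exact hp (Fin.ext (by simp; omega))
      · simp
    · exact sum_eq_zero fun p _ => by rw [if_neg]; omega
  rw [h1, h2]
  have := x.isLt
  split_ifs <;> omega

/-- A vertex of `A_{m+1}` has two incidences if it is inner and one otherwise. [folklore] -/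
theorem ninc_eq {m : ℕ} (v : V (m + 1)) : ninc v = if IsInner v then 2 else 1 := by
  rcases v with ⟨x, y⟩ | ⟨p, y⟩
  · simp only [ninc, IsInner]; exact sum_sum_indicator_eq x
  · simp only [ninc, IsInner]; exact sum_sum_indicator_eq y

/-- Boundary degrees of complementary type families add up to the number of incidences. [folklore] -/
theorem bdeg_add_bdeg_compl {m : ℕ} (τ : Cell m → BType) (v : V m) :
    bdeg τ v + bdeg (fun c => complT (τ c)) v = ninc v := by
  rcases v with ⟨x, y⟩ | ⟨p, y⟩
  · simp only [bdeg, ninc, ← sum_add_distrib]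
    refine sum_congr rfl fun p _ => sum_congr rfl fun δ _ => ?_
    by_cases h : p.val + δ.val = x.val
    · by_cases h' : δ ∈ (τ (p, y)).1 <;> simp [complT, h, h']
    · simp [h]
  · simp only [bdeg, ninc, ← sum_add_distrib]
    refine sum_congr rfl fun q _ => sum_congr rfl fun ε _ => ?_
    by_cases h : q.val + ε.val = y.val
    · by_cases h' : ε ∈ (τ (p, q)).2 <;> simp [complT, h, h']
    · simp [h]

/-- Consistency with all of `A_{m+1}` is consistency of the complementary family with the inner
vertices (the bijection between boundary conditions before and after renewal). [cite: Propp2003, §5] -/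
theorem cons_univ_iff_cons_inner_compl {m : ℕ} (τ : Cell (m + 1) → BType) :
    Cons univ τ ↔ Cons (inner m) (fun c => complT (τ c)) := by
  unfold Cons
  refine forall_congr' fun v => ?_
  have h := bdeg_add_bdeg_compl τ v
  rw [ninc_eq] at h
  simp only [mem_univ, if_true, mem_inner]
  by_cases hi : IsInner v
  · simp only [hi, if_true] at h ⊢; omega
  · simp only [hi, if_false] at h ⊢; omega

/-- Complementation of type families, as an equivalence. [folklore] -/
def complFamily (m : ℕ) : (Cell m → BType) ≃ (Cell m → BType) where
  toFun τ := fun c => complT (τ c)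
  invFun τ := fun c => complT (τ c)
  left_inv τ := by funext c; simp
  right_inv τ := by funext c; simp

/-- **One round of generalized domino shuffling** (Propp 2003, §2 statement, §5 proof): if no cell
factor vanishes, the dimer partition function of the weighted Aztec diamond of order `m + 1` equals
the product of its `(m+1)²` cell factors times the partition function of its inner vertices with the
renewed weights. [cite: Propp2003, §5] -/
theorem Z_univ_eq_prod_cf_mul_Z_inner {m : ℕ} {F : Type*} [Field F] (ew : E (m + 1) → F)
    (hcf : ∀ c, cf ew c ≠ 0) :
    Z univ ew = (∏ c : Cell (m + 1), cf ew c) * Z (inner m) (rt ew) := by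
  rw [Z_eq_sum_cons, Z_eq_sum_cons, mul_sum]
  refine (Fintype.sum_equiv (complFamily (m + 1)) _ _ fun τ => ?_)
  simp only [complFamily, Equiv.coe_fn_mk]
  rw [if_congr (cons_univ_iff_cons_inner_compl τ) rfl rfl]
  split_ifs with h
  · rw [← prod_mul_distrib]
    refine prod_congr rfl fun c _ => ?_
    exact Zloc_eq_cf_mul_Zloc_compl (fun p => ew (c, p)) (hcf c) (τ c)
  · simp

end

end SquareGridDimers

end Summit.ValiantsHypothesis.ValiantsHypothesis.Theorems
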